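import Summits.QuantumFields.BalabanUV.T4Continuum.Spine.NE7.QLaFlatAveragingL1
import Literature.Analysis.Complex.RungeUnits

/-!
# Spine/NE7/QLaFlatAveragingLip — the TWO-SIDED one-bond Lipschitz form of [Balaban1985Averaging] Prop. 5 (156) at the
# flat background for the B7 fold's concrete `k`-fold double-bar averaging on `ℤ^d`, in logarithmic coordinates AND on the
# group: exactly clauses (i)–(ii) of the torus-side shape `FramedBondLip` (file 12), stated for `B7Prop4Flat.dbavgIter`

Cell `pub-balaban-gaps` (YM blitz Y1, track G2, seat `ne7`, generation 5); text of record
`run/shared/lean/pub/pub-balaban-gaps/ne/NE7.md` v5 §4sexies, census row R39; scoping note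
`pub-balaban-gaps-ne7/g5/HALF-B-SCOPE.md` (O3).  Fourteenth `Spine/NE7/` file; companion of file 11 `QLaFlatAveragingL1`
(one-sided: a bond switched on from `0`) and file 12 `QLaBondDeviationBridge` (the torus-side shape `FramedBondLip av dom Cb θ`:
(i) the framed average of the trivial configuration is trivial; (ii) two domain configurations differing at ONE bond have framed
averages differing, bond by bond, by at most `Cb·θⁿ·(size of the change)`).

WHAT THIS FILE PROVES (kernel, 0 sorry; B7 fold's objects on `ℤ^d`, flat background, b07's smallness `C₃(d,L)·L^k·b ≤ 1`, `L ≥ 2`):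
* §1 `norm_logIter_sub_le_one_bond` — clause (ii) in logarithmic coordinates: for `B, B′` in the polydisc `sup ‖·‖ ≤ b`
  agreeing off one fine bond `⟨y, y+e_μ⟩`, at EVERY coarse bond `c`,
  `‖Q_k(1,B′)(c) − Q_k(1,B)(c)‖ ≤ (L^k·L^{−kd} + C₃(L^k)²L^{−kd}b)·‖B′_{yμ} − B_{yμ}‖` (`= (1 + C₃L^kb)·L^{(1−d)k}·‖B′_{yμ} − B_{yμ}‖`)
  — b07's per-bond line derivative `prop5_flat_156_B` integrated along `t ↦ B + t(B′ − B)`, which stays in the polydisc by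
  CONVEXITY of the sup-ball (file 11's `norm_logIter_add_bump_sub_le` is the case `B_{yμ} = 0`); and it VANISHES when the bond
  is outside the box of `c` (`logIter_eq_of_agree_off_bond_not_bondIn`, locality).
* §2 `dbavgIter_one` — clause (i): the `k`-fold double-bar average of the trivial configuration is trivial
  (`U̿^k[e^{0}] = e^{Q_k(1,0)} = e^0 = 1`).
* §3 `norm_dbavgIter_sub_le_one_bond` — clause (ii) ON THE GROUP (`‖1‖ = 1` assumed): `‖U̿^k[e^{B′}](c) − U̿^k[e^{B}](c)‖ ≤
  e·(L^k·L^{−kd} + C₃(L^k)²L^{−kd}b)·‖B′_{yμ} − B_{yμ}‖` — §1 composed with the tree's exponential Lipschitz lemma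
  `Literature.Analysis.Complex.norm_exp_sub_exp_le` on the ball `‖Q_k‖ ≤ 2L^kb ≤ 1` ((131), `prop4_flat_induction`).
So on `ℤ^d` the double-bar average `dbavgIter` satisfies LITERALLY the two clauses of `FramedBondLip` with `Cb = e·(1 + C₃L^kb) ≤ 2e`,
`θ = L^{1−d}`, the frames (110) being built into `dbavg` ((89): `V̿ = v(c₋)⁻¹V̄v(c₊)`); what is left for the torus instance is the
dictionary (O1)∕(O2) of `HALF-B-SCOPE.md` — no analysis.

HONEST FRAMING.  As file 11: a theorem about the B7 fold's concrete model of (15)∕(89)∕(127) at `U₀ = 1` on `ℤ^d` (b07's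
DIVERGENCES inherited); no torus, no (158)-box domains; nothing of the paper asserted beyond what b07 proved.  [folklore]
bookkeeping; (QL-a) NOT IN PRINT ([Balaban1989LargeFieldII] p. 356); NE7 NOT proved; spine 0∕9; fixed finite T⁴ — NOT ℝ⁴, NOT
infinite volume, NOT a mass gap, NOT Clay.
-/

noncomputable section

open scoped BigOperators
open NormedSpace Finset Set

namespace Summit.QuantumFields.BalabanUV.T4Continuum.Spine.NE7.B7Flat

open Literature.MathematicalPhysics.QuantumFieldTheory.Balaban1983to89.B7Prop1Explicit (Site e expUnit val_expUnit)
open Literature.MathematicalPhysics.QuantumFieldTheory.Balaban1983to89.B7Prop1Local (InBox AgreeOn loK bondHiK)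
open Literature.MathematicalPhysics.QuantumFieldTheory.Balaban1983to89.B7Prop3Flat
open Literature.MathematicalPhysics.QuantumFieldTheory.Balaban1983to89.B7Prop4Flat
open Literature.MathematicalPhysics.QuantumFieldTheory.Balaban1983to89.B7Prop5Flat

variable {d : ℕ}

section Log

variable {𝔸 : Type*} [NormedRing 𝔸] [NormedAlgebra ℂ 𝔸] [CompleteSpace 𝔸]

/-! ## §1 Clause (ii) in logarithmic coordinates: two-sided one-bond Lipschitz bound -/

omit [NormedAlgebra ℂ 𝔸] [CompleteSpace 𝔸] in
/-- Two bond fields agreeing off the bond `⟨y, y+e_μ⟩` differ by a single-bond variation: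
`B′ = B + (B′_{yμ} − B_{yμ})·δ_{yμ}`. [folklore] -/
theorem eq_add_bump_of_agree_off_bond (B B' : Site d → Fin d → 𝔸) (y : Site d) (μ : Fin d)
    (hagree : ∀ x κ, ¬(x = y ∧ κ = μ) → B x κ = B' x κ) :
    B' = B + bump y μ (B' y μ - B y μ) := by
  funext x κ
  simp only [Pi.add_apply, bump]
  split_ifs with h
  · obtain ⟨rfl, rfl⟩ := h; abel
  · rw [add_zero, hagree x κ h]

/-- **TWO-SIDED ONE-BOND LIPSCHITZ BOUND FOR `Q_k(1, ·)` — clause (ii) of `FramedBondLip` on `ℤ^d`, logarithmic coordinates**: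
for `B, B′` in b07's polydisc (`sup ‖·‖ ≤ b`, `C₃(d,L)·L^k·b ≤ 1`, `L ≥ 2`) agreeing off ONE fine bond `⟨y, y+e_μ⟩`, every
`k`-fold averaged logarithmic bond variable moves by at most `(L^k·L^{−kd} + C₃(L^k)²L^{−kd}·b)·‖B′_{yμ} − B_{yμ}‖` — the
per-entry bound [Balaban1985Averaging] Prop. 5 (156) at `U₀ = 1` (`B7Prop5Flat.prop5_flat_156_B`) integrated along the segment
`t ∈ [0,1] ↦ B + t·(B′ − B)`, inside the polydisc by convexity of the sup-ball. [cite: Balaban1985Averaging, Prop. 5 (156) p.42, (137)–(138) p.39] -/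
theorem norm_logIter_sub_le_one_bond (L : ℕ) (hL : 2 ≤ L) (B B' : Site d → Fin d → 𝔸) {b : ℝ} (hb : 0 ≤ b)
    (hB : ∀ x κ, ‖B x κ‖ ≤ b) (hB' : ∀ x κ, ‖B' x κ‖ ≤ b) (k : ℕ) (hk : C3 d L * ((L : ℝ) ^ k * b) ≤ 1)
    (y : Site d) (μ : Fin d) (hagree : ∀ x κ, ¬(x = y ∧ κ = μ) → B x κ = B' x κ) (z : Site d) (κ : Fin d) :
    ‖logIter L B' k z κ - logIter L B k z κ‖
      ≤ ((L : ℝ) ^ k * (((L : ℝ) ^ k) ^ d)⁻¹ + K5 d L b k) * ‖B' y μ - B y μ‖ := by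
  set X : 𝔸 := B' y μ - B y μ with hXdef
  set D : Site d → Fin d → 𝔸 := bump y μ X with hD
  have hBB' : B' = B + D := by rw [hD, hXdef]; exact eq_add_bump_of_agree_off_bond B B' y μ hagree
  set Φ : ℂ → 𝔸 := fun τ => logIter L (B + τ • D) k z κ with hΦ
  set F' : ℝ → 𝔸 := fun t => dC L (B + (t : ℂ) • D) D k z κ + linQIter L D k z κ with hF'
  -- the real segment stays inside the polydisc (convexity of the sup-ball at the bond `(y, μ)`)
  have hpoly : ∀ t : ℝ, t ∈ Icc (0 : ℝ) 1 → ∀ x κ', ‖(B + (t : ℂ) • D) x κ'‖ ≤ b := by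
    intro t ht x κ'
    simp only [Pi.add_apply, Pi.smul_apply, hD, bump]
    split_ifs with h
    · obtain ⟨rfl, rfl⟩ := h
      have hconv : B x κ' + (t : ℂ) • X = ((1 - t : ℝ) : ℂ) • B x κ' + (t : ℂ) • B' x κ' := by
        rw [hXdef, smul_sub, Complex.ofReal_sub, Complex.ofReal_one, sub_smul, one_smul]
        abel
      rw [hconv]
      calc ‖((1 - t : ℝ) : ℂ) • B x κ' + (t : ℂ) • B' x κ'‖
          ≤ ‖((1 - t : ℝ) : ℂ) • B x κ'‖ + ‖(t : ℂ) • B' x κ'‖ := norm_add_le _ _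
        _ = (1 - t) * ‖B x κ'‖ + t * ‖B' x κ'‖ := by
            rw [norm_smul, norm_smul, Complex.norm_real, Complex.norm_real, Real.norm_eq_abs, Real.norm_eq_abs,
              abs_of_nonneg (by linarith [ht.2]), abs_of_nonneg ht.1]
        _ ≤ (1 - t) * b + t * b := add_le_add (mul_le_mul_of_nonneg_left (hB x κ') (by linarith [ht.2]))
            (mul_le_mul_of_nonneg_left (hB' x κ') ht.1)
        _ = b := by ring
    · rw [smul_zero, add_zero]; exact hB x κ'
  have hderC : ∀ t : ℝ, t ∈ Icc (0 : ℝ) 1 →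
      HasDerivAt Φ (F' t) (t : ℂ) ∧ ‖F' t‖ ≤ ((L : ℝ) ^ k * (((L : ℝ) ^ k) ^ d)⁻¹ + K5 d L b k) * ‖X‖ := by
    intro t ht
    obtain ⟨h1, h2⟩ := prop5_flat_156_B L hL (B + (t : ℂ) • D) hb (hpoly t ht) k hk y μ X z κ
    refine ⟨hasDerivAt_of_shift ?_, h2⟩
    have h1' : HasDerivAt (fun τ : ℂ => logIter L (B + (t : ℂ) • D + τ • D) k z κ) (F' t) 0 := h1
    refine h1'.congr_of_eventuallyEq (Filter.Eventually.of_forall fun τ => ?_)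
    show Φ ((t : ℂ) + τ) = logIter L (B + (t : ℂ) • D + τ • D) k z κ
    simp only [hΦ, add_smul, add_assoc]
  have hderR : ∀ t ∈ Icc (0 : ℝ) 1, HasDerivWithinAt (fun s : ℝ => Φ (s : ℂ)) (F' t) (Icc (0 : ℝ) 1) t :=
    fun t ht => (hasDerivAt_comp_ofReal (hderC t ht).1).hasDerivWithinAt
  have hmv := norm_image_sub_le_of_norm_deriv_le_segment_01' hderR
    (fun t ht => (hderC t (Ico_subset_Icc_self ht)).2)
  have h1 : Φ ((1 : ℝ) : ℂ) = logIter L B' k z κ := by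
    simp only [hΦ, Complex.ofReal_one, one_smul, hBB']
  have h0 : Φ ((0 : ℝ) : ℂ) = logIter L B k z κ := by
    simp only [hΦ, Complex.ofReal_zero, zero_smul, add_zero]
  rw [h1, h0] at hmv
  exact hmv

/-- LOCALITY, two-sided form: two bond fields agreeing off a fine bond NOT contained in the box of the coarse bond `c` have the
same `Q_k(1, ·)(c)` (b07's `logIter_congr`). [cite: Balaban1985Averaging, p.24 (after (43)), p.31 (after (91))] -/
theorem logIter_eq_of_agree_off_bond_not_bondIn (L : ℕ) (hL : 1 ≤ L) (B B' : Site d → Fin d → 𝔸) (k : ℕ)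
    (y : Site d) (μ : Fin d) (hagree : ∀ x κ, ¬(x = y ∧ κ = μ) → B x κ = B' x κ) (z : Site d) (κ : Fin d)
    (hnot : ¬ BondIn (loK L k z) (bondHiK L k z κ) y μ) :
    logIter L B' k z κ = logIter L B k z κ := by
  rw [eq_add_bump_of_agree_off_bond B B' y μ hagree]
  exact logIter_add_bump_eq_of_not_bondIn L hL B k y μ _ z κ hnot

/-! ## §2 Clause (i): the double-bar average of the trivial configuration is trivial -/

/-- **`U̿^k[1] = 1`** — the `k`-fold double-bar average (90)–(91) of the trivial configuration `e^{0}` is trivial: by b07's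
`dbavgIter_eq_expCfg_logIter` it is `e^{Q_k(1,0)}` and `Q_k(1,0) = 0` (`logIter_zero_field`).  Clause (i) of `FramedBondLip` on
`ℤ^d`. [cite: Balaban1985Averaging, (90)–(91) p.31, (127) p.37] -/
theorem dbavgIter_one (L : ℕ) (hL : 2 ≤ L) (k : ℕ) (z : Site d) (κ : Fin d) :
    ((dbavgIter L (expCfg (0 : Site d → Fin d → 𝔸)) k z κ : 𝔸ˣ) : 𝔸) = 1 := by
  have hL1 : 1 ≤ L := le_trans (by norm_num) hL
  have hc4 : (L : ℝ) ^ k * 0 ≤ c4 d := by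
    rw [mul_zero]; have := C1_pos d; unfold c4; positivity
  have h := dbavgIter_eq_expCfg_logIter L hL (0 : Site d → Fin d → 𝔸) le_rfl (fun _ _ => by simp) k hc4 le_rfl
  rw [h, logIter_zero_field L hL1 k]
  simp [expCfg]

end Log

/-! ## §3 Clause (ii) on the group: the averaged bond variables themselves -/

section Group

variable {𝔸 : Type*} [NormedRing 𝔸] [NormedAlgebra ℂ 𝔸] [CompleteSpace 𝔸] [NormOneClass 𝔸]

/-- **TWO-SIDED ONE-BOND LIPSCHITZ BOUND ON THE GROUP — clause (ii) of `FramedBondLip` on `ℤ^d`**: under b07's smallness, for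
`B, B′` in the polydisc agreeing off one fine bond, every `k`-fold double-bar averaged bond VARIABLE `U̿^k[e^{·}](c)` (b07's
`dbavgIter`, (90)–(91)) moves by at most `e·(L^k·L^{−kd} + C₃(L^k)²L^{−kd}b)·‖B′_{yμ} − B_{yμ}‖` — §1 composed with
`U̿^k = e^{Q_k}` (`dbavgIter_eq_expCfg_logIter`), (131) `‖Q_k‖ ≤ 2L^kb ≤ 1` and the exponential Lipschitz lemma
`Literature.Analysis.Complex.norm_exp_sub_exp_le`. [cite: Balaban1985Averaging, Prop. 5 (156) p.42, (131) p.38, (90)–(91) p.31] -/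
theorem norm_dbavgIter_sub_le_one_bond (L : ℕ) (hL : 2 ≤ L) (B B' : Site d → Fin d → 𝔸) {b : ℝ} (hb : 0 ≤ b)
    (hB : ∀ x κ, ‖B x κ‖ ≤ b) (hB' : ∀ x κ, ‖B' x κ‖ ≤ b) (k : ℕ) (hk : C3 d L * ((L : ℝ) ^ k * b) ≤ 1)
    (y : Site d) (μ : Fin d) (hagree : ∀ x κ, ¬(x = y ∧ κ = μ) → B x κ = B' x κ) (z : Site d) (κ : Fin d) :
    ‖((dbavgIter L (expCfg B') k z κ : 𝔸ˣ) : 𝔸) - ((dbavgIter L (expCfg B) k z κ : 𝔸ˣ) : 𝔸)‖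
      ≤ Real.exp 1 * (((L : ℝ) ^ k * (((L : ℝ) ^ k) ^ d)⁻¹ + K5 d L b k) * ‖B' y μ - B y μ‖) := by
  have hL1 : 1 ≤ L := le_trans (by norm_num) hL
  obtain ⟨hc4, h2b⟩ := smallness_of_C3 L hL1 hb k hk
  have hC1 := C1_pos d
  have hk8 : 8 * C1 d * ((L : ℝ) ^ k * b) ≤ 1 := by
    have h := mul_le_mul_of_nonneg_left hc4 (by positivity : (0 : ℝ) ≤ 8 * C1 d)
    rwa [c4, mul_one_div_cancel (by positivity)] at h
  have hval : ∀ {B₀ : Site d → Fin d → 𝔸}, (∀ x κ', ‖B₀ x κ'‖ ≤ b) →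
      ((dbavgIter L (expCfg B₀) k z κ : 𝔸ˣ) : 𝔸) = exp (logIter L B₀ k z κ) ∧ ‖logIter L B₀ k z κ‖ ≤ 1 := by
    intro B₀ hB₀
    refine ⟨?_, ((prop4_flat_induction L hL B₀ hb hB₀ k hk8 k le_rfl).2.2 z κ).trans h2b⟩
    rw [dbavgIter_eq_expCfg_logIter L hL B₀ hb hB₀ k hc4 le_rfl]; rfl
  obtain ⟨hv', hn'⟩ := hval hB'
  obtain ⟨hv, hn⟩ := hval hB
  rw [hv', hv]
  calc ‖exp (logIter L B' k z κ) - exp (logIter L B k z κ)‖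
      ≤ ‖logIter L B' k z κ - logIter L B k z κ‖ * Real.exp (max ‖logIter L B' k z κ‖ ‖logIter L B k z κ‖) :=
        Literature.Analysis.Complex.norm_exp_sub_exp_le _ _
    _ ≤ (((L : ℝ) ^ k * (((L : ℝ) ^ k) ^ d)⁻¹ + K5 d L b k) * ‖B' y μ - B y μ‖) * Real.exp 1 :=
        mul_le_mul (norm_logIter_sub_le_one_bond L hL B B' hb hB hB' k hk y μ hagree z κ)
          (Real.exp_le_exp.2 (max_le hn' hn)) (by positivity) (by
            have := K5_nonneg d L hb k; positivity)
    _ = _ := by ring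

end Group

end Summit.QuantumFields.BalabanUV.T4Continuum.Spine.NE7.B7Flat

end
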